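import Summits.CriticalPhenomena.CardyFormulaZ2.Theorems.CardyComplexConeParafermionToSLESixFamiliesFaceKernelInnerNearCompact
import Summits.CriticalPhenomena.CardyFormulaZ2.Theorems.CardyComplexConeParafermionToSLESixFamiliesFaceKernelWPathConnected
import Summits.CriticalPhenomena.CardyFormulaZ2.Theorems.CardyComplexConeParafermionToSLESixFamiliesFaceKernelEastMarch
import Summits.CriticalPhenomena.CardyFormulaZ2.Theorems.CardyComplexConeParafermionToSLESixFamiliesFaceKernelVertexNear
import Summits.CriticalPhenomena.CardyFormulaZ2.Theorems.CardyComplexConeParafermionToSLESixFamiliesFaceKernelPercFaceK1Of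
import Summits.CriticalPhenomena.CardyFormulaZ2.Theorems.CardyComplexConeParafermionToSLESixFamiliesOfSlitMartingaleData
import HarnessLib

/-!
# (K1) holds: compacts of the Jordan domain lie in the oriented face domains of small admissible mesh

Route `CardyComplexCone` (sub-problem `CriticalPhenomena/CardyFormulaZ2`), crux
`Summit.CriticalPhenomena.CardyFormulaZ2.Theses.CardyComplexCone.ParafermionToSLESixFamilies`
(item stmt-CriticalPhenomena-11389), line `face-kernel-k1` (lead c4).

The kernel input (K1) `PercFaceK1` of Pommerenke's convergence theorem for the polygonal
approximations of a bond-percolation discretisation family — isolated as "the one remaining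
unformalised geometric input of `PercKSBoxData`" in `…PercKSBoxFaceReduction2.lean` — is now a
THEOREM (`percFaceK1`): the assembly `stub_percFaceK1_of` fed with the four landed lattice /
topology stubs of the line. Consequences recorded by name:

* `percFaceKernel : PercFaceKernel` ((K1) + (ULC), the full hypothesis pair `hK1`, `hlc` of
  `MarkedDomain.exists_uniformizers_of_kernel(_of_isChordalUniformizing)` for the oriented face
  domains);
* `percKSBoxData_of_boxTight : PercFaceBoxTight → PercKSBoxData` — the Kemppainen–Smirnov
  lattice data of a bond-percolation discretisation family now rest on box tightness ALONE
  (Condition G2 / RSW for the raw medial exploration polyline);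
* `parafermionToSLESixFamilies_of_boxTight_of_paraApprox : PercFaceBoxTight → PercParaApprox → crux`
  — the crux from its two research inputs (cf. `parafermionToSLESixFamilies_of_percData`).
-/

noncomputable section

open Summit.CriticalPhenomena.CardyFormulaZ2.Cruxes.ParafermionToSLESixFamilies.CaratheodoryNetSlitUniformity

namespace Summit.CriticalPhenomena.CardyFormulaZ2.Cruxes.ParafermionToSLESixFamilies.FaceKernel

/-- **(K1) holds**: for every Dobrushin domain `(D; a, b)`, every discretisation family `Λ` and
all positive admissible meshes `δ_k → 0`, every compact subset of `D` lies in the oriented face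
domain of `Λ δ_k` for all large `k`. -/
theorem percFaceK1 : PercFaceK1 :=
  stub_percFaceK1_of stub_isInnerFace_near_compact stub_W_eq_of_isPathConnected
    stub_exists_isOutEdge_east stub_exists_vertex_near

/-- **The kernel inputs (K1) + (ULC) of the oriented face domains hold.** -/
theorem percFaceKernel : PercFaceKernel :=
  percFaceKernel_of_K1 percFaceK1

/-- **`PercKSBoxData` from Kemppainen–Smirnov box tightness alone.** -/
theorem percKSBoxData_of_boxTight : PercFaceBoxTight → PercKSBoxData :=
  percKSBoxData_of_K1 percFaceK1

/-- **The crux from its two research inputs**: box tightness of the interfaces (Condition G2 /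
RSW) and the slit-observable martingale approximation (identification + slit uniformity). -/
theorem parafermionToSLESixFamilies_of_boxTight_of_paraApprox :
    PercFaceBoxTight → PercParaApprox →
      Summit.CriticalPhenomena.CardyFormulaZ2.Theses.CardyComplexCone.ParafermionToSLESixFamilies :=
  fun h1 h2 => parafermionToSLESixFamilies_of_percData (percKSBoxData_of_boxTight h1) h2

end Summit.CriticalPhenomena.CardyFormulaZ2.Cruxes.ParafermionToSLESixFamilies.FaceKernel

end
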